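import Literature.MathematicalPhysics.QuantumFieldTheory.Balaban1983to89.B7Eq99Concrete
import Literature.MathematicalPhysics.QuantumFieldTheory.Balaban1983to89.B7Eq31BCH

/-!
# B7 Sect. F, (168)–(170) pp. 44–45: the product formula for averaged gauge transformations,
`(R̄₀v)(y) = (R̄₀v₁)(y)(R̄₀v₂)(y)e^{ir̄(y)}`, `|r̄(y)| < c₁ + C₃(c₁ + c₂)²` — kernel form at the flat background with an
explicit constant (`B7Eq170Flat`)

Source: T. Bałaban, *Averaging operations for lattice gauge theories*, Commun. Math. Phys. **98** (1985) 17–51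
[cite: Balaban1985Averaging], Sect. F pp. 44–45, displays (168), (169), (170), with (31) p. 22 (`B7Eq31BCH`), (56)–(57) p. 27
(`B7Eq92Concrete`) and the block average (78) p. 30 in its exponential form (`B7Eq99Concrete.savg`, `Sexp`) as inputs.
Page numbers are journal pages; every quotation below was read on the page renders (journal page = render page + 16).

## What this file is

The ONE-STEP PRODUCT LEMMA of Sect. F — the computation (168)–(169) and its conclusion (170), which is the engine of the
induction (171)–(175) proving Proposition 8 — typed and KERNEL-PROVED at the flat background `V₀ = 1` over a complete normed
`ℂ`-algebra `𝔸`, with every `O((c₁ + c₂)²)` replaced by an explicit bound.  Print (p. 44): "We need to consider a product of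
two gauge transformations satisfying (166), (167), so we would like to know that it also satisfies similar conditions.  Let
us consider at first the following situation: we have functions v, v₁, v₂ defined on a lattice Ω′ and a gauge field
configuration V₀, and we assume that v(x) = v₁(x)v₂(x)e^{ir(x)}, |r(x)| < c₁, |v_i⁻¹(y)(R_{0,y}v_i)(x) − 1| < c₂, i = 1, 2,
x ∈ B(y), y ∈ Ω′^{(1)}.  We will find relations between R̄₀v and R̄₀v₁, R̄₀v₂, and bounds satisfied by R̄₀v.  We have
  v⁻¹(y)(R_{0,y}v)(x) = e^{−ir(y)}v₂⁻¹(y)v₁⁻¹(y)(R_{0,y}v₁)(x)·(R_{0,y}v₂)(x)e^{i(R_{0,y}r)(x)}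
   = e^{−ir(y)}R(v₂⁻¹(y))[v₁⁻¹(y)(R_{0,y}v₁)(x)]·v₂⁻¹(y)(R_{0,y}v₂)(x)e^{i(R_{0,y}r)(x)}
   = exp[−ir(y) + iR(v₂⁻¹(y))(1/i) log v₁⁻¹(y)(R_{0,y}v₁)(x) + i(1/i) log v₂⁻¹(y)(R_{0,y}v₂)(x) + i(R_{0,y}r)(x) + O((c₁ + c₂)²)],  (168)
hence
  (R̄₀v)(y) = v(y) exp[i Σ_{x∈B(y)} L^{−d} log v⁻¹(y)(R_{0,y}v)(x)] = v₁(y)v₂(y)·exp[ir(y) + i Σ_{x∈B(y)} L^{−d} log v⁻¹(y)(R_{0,y}v)(x) + O((c₁ + c₂)²)]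
   = v₁(y)v₂(y) exp[i Σ L^{−d}R(v₂⁻¹(y))(1/i) log v₁⁻¹(y)(R_{0,y}v₁)(x) + i Σ L^{−d}(1/i) log v₂⁻¹(y)(R_{0,y}v₂)(x) + i Σ L^{−d}(R_{0,y}r)(x) + O((c₁ + c₂)²)]
   = v₁(y)v₂(y)R(v₂⁻¹(y)) exp[i Σ L^{−d}(1/i) log v₁⁻¹(y)(R_{0,y}v₁)(x)]·exp[i Σ L^{−d}(1/i) log v₂⁻¹(y)(R_{0,y}v₂)(x)]·exp[i Σ L^{−d}(R_{0,y}r)(x) + O((c₁ + c₂)²)]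
   = (R̄₀v₁)(y)(R̄₀v₂)(y)e^{ir̄(y)}, |r̄(y)| < c₁ + O((c₁ + c₂)²).  (169)"
and (p. 45): "Let us denote the constant in the above bound by C₃, so we have
  (R̄₀v)(y) = (R̄₀v₁)(y)(R̄₀v₂)(y)e^{ir̄(y)}, |r̄(y)| < c₁ + C₃(c₁ + c₂)², y ∈ Ω′^{(1)}.  (170)"

THE THEOREMS (all sorry-free; `𝔸` a complete normed `ℂ`-algebra, `G`-valued objects in `𝔸ˣ`):
* §1 `bchRem`, `norm_bchRem_le`, `exp_mul_exp_eq` — merging two exponentials to second order, `e^A e^B = e^{A+B+σ(A,B)}`,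
  `‖σ(A,B)‖ ≤ 2‖A‖‖B‖` for `‖A‖ + ‖B‖ ≤ 1/5` ((31), `B7Eq31BCH.eq31_of_sum_le`, and `exp ∘ log = id`, `MatrixLog.exp_mlog`);
  `exp_mul4_eq` — four exponentials: `e^{B₁}e^{B₂}e^{B₃}e^{B₄} = e^{ΣB_i + ρ}`, `‖ρ‖ ≤ 5s²` when `Σ‖B_i‖ ≤ s ≤ 1/20`; `mlog_exp_of_le`.
* §2 `cj` (the rotation `R(w)X = wXw⁻¹` of (56) on the algebra), its linearity `cj_add/neg/smul/sum`, `val_Rc_eq_cj`, and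
  `norm_cj_le_two_mul` — `‖wXw⁻¹‖ ≤ 2‖X‖` when `‖w − 1‖, ‖w⁻¹ − 1‖ ≤ 2/5`.
* §3 `bmean` (the block mean `Σ_{x∈B(y)} L^{−d}(·)` of (78)), `Sexp_eq_bmean`, `bmean_const/add/neg/cj`, `norm_bmean_le`
  (via `B7Prop1Explicit.sum_weights`, `norm_avg_le`).
* §4 `vprod` (`v = v₁v₂e^{R}`), `exp_cj`, `mlog_cj` ((57)), **`eq168_factor`** ((168) lines 1–2, an identity in `𝔸ˣ`), `rem168` +
  `rem168_spec` ((168) line 3 as an identity defining the remainder `ρ(x)`), **`norm_rem168_le`**: `‖ρ(x)‖ ≤ 5(2c₁ + 6c₂)²` for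
  `2c₁ + 6c₂ ≤ 1/20`.
* §5 `rbar` (`ir̄(y) := log[((R̄₀v₁)(y)(R̄₀v₂)(y))⁻¹(R̄₀v)(y)]`), `rmean`, **`Sexp_vprod`** ((169), the exponent, exact), `quotient_factor`,
  **`eq170_flat`**: `(R̄₀v)(y) = (R̄₀v₁)(y)(R̄₀v₂)(y)e^{r̄(y)}` and `‖r̄(y)‖ ≤ c₁ + 31(2c₁ + 6c₂)²` for `2c₁ + 6c₂ ≤ 1/45`, and
  **`eq170_flat'`**: print's shape `‖r̄(y)‖ ≤ c₁ + C₃(c₁ + c₂)²` with the admissible value `C₃ = 1116` for `c₁, c₂ ≤ 1/400`.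

READINGS (each a typing decision, recorded in the cell's DIVERGENCE.md):
(a) FLAT BACKGROUND `V₀ = 1`: then `R_{0,y} = R(V₀(Γ_{y,x})) = id`, `(R_{0,y}v)(x) = v(x)`, `(R_{0,y}r)(x) = r(x)`, and `R̄₀` is the
    plain block average (78) in exponential form, `B7Eq99Concrete.savg L v y = v(y) exp[Σ_{x∈B(y)} L^{−d} log v⁻¹(y)v(x)]`
    (`= R0avg L 1 v y`, `B7Eq99Concrete.R0avg_one_left`).  The curved case needs `R_{0,y}` acting on both `v_i` and `r` and is NOT typed here.
(b) VALUES: print's `G ⊂ U(N)`, `|·|` the operator norm, `e^{ir}` with `r` in the Lie algebra; here `𝔸` is any complete normed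
    `ℂ`-algebra, group elements are units, `ir(x)` is an element `R x : 𝔸` (so `e^{ir(x)}` is `exp (R x)`, `B7Prop1Explicit.expUnit`),
    `(1/i) log` is the series (21) `MatrixLog.mlog`, and `ir̄(y)` is `rbar … : 𝔸`.  `<` is typed `≤` throughout.
(c) UNITARITY → EXPLICIT NEAR-ISOMETRY: print uses `|R(v₂⁻¹(y))X| = |X|` (conjugation by a unitary is an isometry).  In a general
    `𝔸` this fails, so the theorems carry the hypotheses `‖v₂⁻¹(y) − 1‖ ≤ 2/5`, `‖v₂(y) − 1‖ ≤ 2/5`, under which `‖R(v₂⁻¹(y))X‖ ≤ 2‖X‖`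
    (`norm_cj_le_two_mul`); in the application (Prop. 8, `v₂ = ū₂ʲ`) they are instances of (166).  The factor 2 (instead of 1)
    is the only place where the constants below exceed what print's argument gives for unitary matrices.
(d) EXPLICIT SMALLNESS AND CONSTANTS: print's "O((c₁ + c₂)²)" with `c₁, c₂` implicitly small becomes `‖ρ(x)‖ ≤ 5(2c₁ + 6c₂)²` under
    `2c₁ + 6c₂ ≤ 1/20` in (168) and `‖r̄(y)‖ ≤ c₁ + 31(2c₁ + 6c₂)² ≤ c₁ + 1116(c₁ + c₂)²` under `2c₁ + 6c₂ ≤ 1/45` (e.g. `c₁, c₂ ≤ 1/400`)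
    in (170); print's `C₃` is "the constant in the above bound", unprinted — `1116` is AN admissible value in this reading, not print's.
(e) THE BLOCK: `B(y) = {y + r : r ∈ [0, L)^d}` with base point `y` (`B7Prop1Explicit.boxVec`, as in `B7Eq99Concrete`), `L ≥ 1`; the
    hypotheses "x ∈ B(y)" are typed `∀ r`, and `‖R y‖ ≤ c₁` is carried separately (it is the instance `r = 0`).
(f) `r̄(y)` is DEFINED as the logarithm (21) of the quotient `((R̄₀v₁)(y)(R̄₀v₂)(y))⁻¹(R̄₀v)(y)` (print defines it implicitly by
    (169)); the theorem shows this quotient is `exp` of an element of norm `≤ 1/5`, so `r̄(y)` is that element (`mlog_exp_of_le`) and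
    (170) holds with equality of group elements.
(g) (168) line 3 / (169): the `O`-terms are typed as NAMED remainders (`rem168`, and `r̄ − Σ L^{−d}ir(x)`), each with its bound; the
    exact identities `rem168_spec`, `Sexp_vprod`, `quotient_factor` carry print's equalities, the inequalities carry print's `O`.

RELATION TO THE TREE.  `B7.Prop8Printed` / `B7.ineq173_recursion` (abstract `GaugeData` items over an uninterpreted background) and
the cell's hand certification of (168)–(175) are untouched; this file supplies the kernel certificate of the one-step lemma they rest
on, in the same concrete flat setting as `B7Eq99Concrete` ((96)–(99)), `B7Eq106Concrete` ((101)–(108)) and `B7Eq167Flat` ((165)–(167)).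

NOT CLAIMED: Proposition 8 itself — (171)–(172), the "easy induction" (173) `(R̄₀uʲ)(x_j) = (R̄₀u₁ʲ)(x_j)(R̄₀u₂ʲ)(x_j)e^{ir_j(x_j)}`,
`|r_j(x_j)| < 2C₃(α₃Lʲη)²` for `L^{−2}(1 + C₃α₃)² ≤ ½`, and the conclusion (175) for `u = u₁u₂` — is not typed here (it iterates
this lemma along the levels, with the curved `R_{0,x_{j+1}}^j` in general); nor the curved background `V₀ ≠ 1`; nor print's
(unstated) value of `C₃`; nor the isometry of `R(v₂⁻¹(y))` (replaced by hypothesis (c)).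
-/

noncomputable section

open NormedSpace Finset

namespace Literature.MathematicalPhysics.QuantumFieldTheory.Balaban1983to89.B7Eq170Flat

open B7Prop1Explicit MatrixLog B7Prop6Flat B7Eq92Concrete B7Eq99Concrete B7Eq31BCH B7Eq38Remainder

export B7Prop1Explicit (Site)

variable {d : ℕ}

/-! ## §1 Merging exponentials to second order: `e^A e^B = e^{A + B + σ}`, `|σ| ≤ 2|A||B|` ((31) p. 22) -/

section Merge

variable {𝔸 : Type*} [NormedRing 𝔸] [NormedAlgebra ℂ 𝔸] [CompleteSpace 𝔸]

/-- The second-order remainder of the Baker–Campbell–Hausdorff series: `σ(A, B) := log (e^A e^B) − A − B`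
(`log` = the series (21), `MatrixLog.mlog`). [cite: Balaban1985Averaging, (28)/(31) p.22] -/
def bchRem (A B : 𝔸) : 𝔸 := mlog (exp A * exp B) - A - B

omit [CompleteSpace 𝔸] in
/-- `bchRem_def`: unfolding. [cite: Balaban1985Averaging, (31) p.22] -/
theorem bchRem_def (A B : 𝔸) : bchRem A B = mlog (exp A * exp B) - A - B := rfl

/-- **(31)** for the remainder: `‖σ(A, B)‖ ≤ 2‖A‖‖B‖` on `‖A‖ + ‖B‖ ≤ 1/5` (`B7Eq31BCH.eq31_of_sum_le`).
[cite: Balaban1985Averaging, (31) p.22] -/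
theorem norm_bchRem_le {A B : 𝔸} (h : ‖A‖ + ‖B‖ ≤ 1 / 5) : ‖bchRem A B‖ ≤ 2 * ‖A‖ * ‖B‖ :=
  eq31_of_sum_le h

/-- `e^{1/5} − 1 < 1` (radius bookkeeping for the series (21)). [folklore] -/
theorem exp_one_fifth_sub_one_lt_one : Real.exp (1 / 5) - 1 < 1 := by
  linarith [exp_one_fifth_le]

/-- **Merging two exponentials**: for `‖A‖ + ‖B‖ ≤ 1/5`, `e^A e^B = e^{A + B + σ(A,B)}` — `e^A e^B` lies in the domain of
the series (21) (`‖e^A e^B − 1‖ ≤ e^{1/5} − 1 < 1`) and `exp ∘ log = id` there (`MatrixLog.exp_mlog`).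
[cite: Balaban1985Averaging, (28)/(31) p.22, (21) p.21] -/
theorem exp_mul_exp_eq {A B : 𝔸} (h : ‖A‖ + ‖B‖ ≤ 1 / 5) : exp A * exp B = exp (A + B + bchRem A B) := by
  have h1 : ‖exp A * exp B - 1‖ < 1 := by
    refine lt_of_le_of_lt (norm_exp_mul_exp_sub_one_le A B) ?_
    have := Real.exp_le_exp.mpr h
    linarith [exp_one_fifth_sub_one_lt_one]
  rw [bchRem_def, show A + B + (mlog (exp A * exp B) - A - B) = mlog (exp A * exp B) by abel, exp_mlog h1]

/-- **Merging four exponentials** (the form of (38)/(31) used in (168) line 3 and in (169)): if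
`‖B₁‖ + ‖B₂‖ + ‖B₃‖ + ‖B₄‖ ≤ s ≤ 1/20` then `e^{B₁}e^{B₂}e^{B₃}e^{B₄} = e^{B₁ + B₂ + B₃ + B₄ + ρ}` with `‖ρ‖ ≤ 5s²`
(three successive mergings; `ρ = σ₁ + σ₂ + σ₃`). [cite: Balaban1985Averaging, (31) p.22, (168) p.44] -/
theorem exp_mul4_eq {B₁ B₂ B₃ B₄ : 𝔸} {s : ℝ} (hB : ‖B₁‖ + ‖B₂‖ + ‖B₃‖ + ‖B₄‖ ≤ s) (hs : s ≤ 1 / 20) :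
    ∃ ρ : 𝔸, exp B₁ * exp B₂ * exp B₃ * exp B₄ = exp (B₁ + B₂ + B₃ + B₄ + ρ) ∧ ‖ρ‖ ≤ 5 * s ^ 2 := by
  have h1 := norm_nonneg B₁
  have h2 := norm_nonneg B₂
  have h3 := norm_nonneg B₃
  have h4 := norm_nonneg B₄
  -- first merging
  have h12 : ‖B₁‖ + ‖B₂‖ ≤ 1 / 5 := by linarith
  set σ₁ := bchRem B₁ B₂ with hσ₁
  have hσ₁n : ‖σ₁‖ ≤ 2 * ‖B₁‖ * ‖B₂‖ := norm_bchRem_le h12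
  have hb12 : ‖B₁‖ * ‖B₂‖ ≤ s * ‖B₂‖ := mul_le_mul_of_nonneg_right (by linarith) h2
  set E₂ := B₁ + B₂ + σ₁ with hE₂
  have hE₂n : ‖E₂‖ ≤ ‖B₁‖ + ‖B₂‖ + 2 * (s * ‖B₂‖) := by
    calc ‖E₂‖ ≤ ‖B₁‖ + ‖B₂‖ + ‖σ₁‖ := by rw [hE₂]; exact norm_add₃_le
      _ ≤ _ := by linarith
  have hsB₂ : s * ‖B₂‖ ≤ s / 20 := by nlinarith
  -- second merging
  have h23 : ‖E₂‖ + ‖B₃‖ ≤ 1 / 5 := by linarith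
  set σ₂ := bchRem E₂ B₃ with hσ₂
  have hσ₂n : ‖σ₂‖ ≤ 2 * ‖E₂‖ * ‖B₃‖ := norm_bchRem_le h23
  have hE₂s : ‖E₂‖ ≤ 11 / 10 * s := by linarith
  have hσ₂n' : ‖σ₂‖ ≤ 2 * (11 / 10 * s) * ‖B₃‖ := hσ₂n.trans (by gcongr)
  have hsB₃ : s * ‖B₃‖ ≤ s / 20 := by nlinarith
  set E₃ := E₂ + B₃ + σ₂ with hE₃
  have hE₃n : ‖E₃‖ ≤ ‖E₂‖ + ‖B₃‖ + ‖σ₂‖ := by rw [hE₃]; exact norm_add₃_le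
  have hE₃s : ‖E₃‖ ≤ 23 / 10 * s := by nlinarith
  -- third merging
  have h34 : ‖E₃‖ + ‖B₄‖ ≤ 1 / 5 := by linarith
  set σ₃ := bchRem E₃ B₄ with hσ₃
  have hσ₃n : ‖σ₃‖ ≤ 2 * ‖E₃‖ * ‖B₄‖ := norm_bchRem_le h34
  have hσ₃n' : ‖σ₃‖ ≤ 2 * (23 / 10 * s) * ‖B₄‖ := hσ₃n.trans (by gcongr)
  refine ⟨σ₁ + σ₂ + σ₃, ?_, ?_⟩
  · rw [exp_mul_exp_eq h12, ← hσ₁, ← hE₂, exp_mul_exp_eq h23, ← hσ₂, ← hE₃, exp_mul_exp_eq h34, ← hσ₃]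
    congr 1
    rw [hE₃, hE₂]; abel
  · calc ‖σ₁ + σ₂ + σ₃‖ ≤ ‖σ₁‖ + ‖σ₂‖ + ‖σ₃‖ := norm_add₃_le
      _ ≤ 2 * (s * ‖B₂‖) + 2 * (11 / 10 * s) * ‖B₃‖ + 2 * (23 / 10 * s) * ‖B₄‖ := by linarith
      _ ≤ 5 * s ^ 2 := by nlinarith

/-- `log e^Z = Z` for `‖Z‖ ≤ 1/5` (`B7BlockAvgLog.mlog_exp` on `‖Z‖ < ln 2`). [cite: Balaban1985Averaging, (21) p.21] -/
theorem mlog_exp_of_le {Z : 𝔸} (hZ : ‖Z‖ ≤ 1 / 5) : mlog (exp Z) = Z := by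
  refine B7BlockAvgLog.mlog_exp (lt_of_le_of_lt hZ ?_)
  rw [Real.lt_log_iff_exp_lt two_pos]
  linarith [exp_one_fifth_le]

end Merge

/-! ## §2 Conjugation by a near-identity unit ("`R(v₂⁻¹(y))`", p. 44) in the Banach reading -/

section Conj

variable {𝔸 : Type*} [NormedRing 𝔸]

/-- The conjugation `X ↦ w X w⁻¹` by a unit `w` (print's rotation `R(w)`, (56) p. 27), on the algebra. [cite: Balaban1985Averaging, (56) p.27] -/
def cj (w : 𝔸ˣ) (X : 𝔸) : 𝔸 := (w : 𝔸) * X * ((w⁻¹ : 𝔸ˣ) : 𝔸)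

/-- `cj_apply`: unfolding. [cite: Balaban1985Averaging, (56) p.27] -/
theorem cj_apply (w : 𝔸ˣ) (X : 𝔸) : cj w X = (w : 𝔸) * X * ((w⁻¹ : 𝔸ˣ) : 𝔸) := rfl

/-- `cj` is additive. [folklore] -/
theorem cj_add (w : 𝔸ˣ) (X Y : 𝔸) : cj w (X + Y) = cj w X + cj w Y := by
  simp only [cj_apply, mul_add, add_mul]

/-- `cj` commutes with negation. [folklore] -/
theorem cj_neg (w : 𝔸ˣ) (X : 𝔸) : cj w (-X) = -cj w X := by
  simp only [cj_apply, mul_neg, neg_mul]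

/-- `cj` is `ℝ`-homogeneous. [folklore] -/
theorem cj_smul [NormedAlgebra ℂ 𝔸] (w : 𝔸ˣ) (c : ℝ) (X : 𝔸) : cj w (c • X) = c • cj w X := by
  simp only [cj_apply, mul_smul_comm, smul_mul_assoc]

/-- `cj` passes through finite sums. [folklore] -/
theorem cj_sum {ι : Type*} (w : 𝔸ˣ) (t : Finset ι) (f : ι → 𝔸) : cj w (∑ i ∈ t, f i) = ∑ i ∈ t, cj w (f i) := by
  simp only [cj_apply, Finset.mul_sum, Finset.sum_mul]

/-- `cj w (X − 1) = cj w X − 1`. [folklore] -/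
theorem cj_sub_one (w : 𝔸ˣ) (X : 𝔸) : cj w X - 1 = cj w (X - 1) := by
  simp only [cj_apply, mul_sub, sub_mul, mul_one, Units.mul_inv]

/-- On units, `cj w` is the rotation `Rc w` of `B7Eq92Concrete` ((56)). [cite: Balaban1985Averaging, (56) p.27] -/
theorem val_Rc_eq_cj (w X : 𝔸ˣ) : ((Rc w X : 𝔸ˣ) : 𝔸) = cj w (X : 𝔸) := by
  simp only [Rc_apply, Units.val_mul, cj_apply]

/-- **Near-isometry of the rotation by a near-identity unit** (print uses `|R(w)X| = |X|` for unitary `w`; in a Banach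
algebra): if `‖w − 1‖ ≤ 2/5` and `‖w⁻¹ − 1‖ ≤ 2/5` then `‖w X w⁻¹‖ ≤ 2‖X‖` (`w X w⁻¹ = X + (w−1)X + X(w⁻¹−1) + (w−1)X(w⁻¹−1)`).
[cite: Balaban1985Averaging, (56)–(57) p.27, (168) p.44] -/
theorem norm_cj_le_two_mul {w : 𝔸ˣ} (hw : ‖(w : 𝔸) - 1‖ ≤ 2 / 5) (hw' : ‖((w⁻¹ : 𝔸ˣ) : 𝔸) - 1‖ ≤ 2 / 5) (X : 𝔸) :
    ‖cj w X‖ ≤ 2 * ‖X‖ := by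
  have hid : cj w X = X + ((w : 𝔸) - 1) * X + X * (((w⁻¹ : 𝔸ˣ) : 𝔸) - 1) +
      ((w : 𝔸) - 1) * X * (((w⁻¹ : 𝔸ˣ) : 𝔸) - 1) := by
    rw [cj_apply]; noncomm_ring
  rw [hid]
  have hX := norm_nonneg X
  calc _ ≤ ‖X‖ + ‖((w : 𝔸) - 1) * X‖ + ‖X * (((w⁻¹ : 𝔸ˣ) : 𝔸) - 1)‖ +
        ‖((w : 𝔸) - 1) * X * (((w⁻¹ : 𝔸ˣ) : 𝔸) - 1)‖ := norm_add₄_le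
    _ ≤ ‖X‖ + 2 / 5 * ‖X‖ + ‖X‖ * (2 / 5) + 2 / 5 * ‖X‖ * (2 / 5) := by
        gcongr
        · exact (norm_mul_le _ _).trans (by gcongr)
        · exact (norm_mul_le _ _).trans (by gcongr)
        · exact (norm_mul_le _ _).trans
            (mul_le_mul ((norm_mul_le _ _).trans (by gcongr)) hw' (norm_nonneg _) (by positivity))
    _ ≤ 2 * ‖X‖ := by linarith

end Conj

/-! ## §3 The block mean `Σ_{x∈B(y)} L^{−d}(·)` of (78) -/

section BlockMean

variable {𝔸 : Type*} [NormedRing 𝔸] [NormedAlgebra ℂ 𝔸]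

/-- The block mean `Σ_{x∈B(y)} L^{−d} f(x)` of (61)/(78), the block points written `x = y + r`, `r ∈ [0, L)^d`
(`B7Prop1Explicit.boxVec`); `B7Eq99Concrete.Sexp L g y` is the block mean of `r ↦ log g(y)⁻¹g(y + r)`.
[cite: Balaban1985Averaging, (78) p.30] -/
def bmean (L : ℕ) (f : (Fin d → Fin L) → 𝔸) : 𝔸 := ∑ r : Fin d → Fin L, (((L : ℝ) ^ d)⁻¹) • f r

/-- `bmean_apply`: unfolding. [cite: Balaban1985Averaging, (78) p.30] -/
theorem bmean_apply (L : ℕ) (f : (Fin d → Fin L) → 𝔸) : bmean L f = ∑ r : Fin d → Fin L, (((L : ℝ) ^ d)⁻¹) • f r := rfl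

/-- `Sexp` is a block mean. [cite: Balaban1985Averaging, (78) p.30] -/
theorem Sexp_eq_bmean (L : ℕ) (g : Site d → 𝔸ˣ) (y : Site d) :
    Sexp L g y = bmean L (fun r => mlog ((((g y)⁻¹ * g (y + boxVec L r) : 𝔸ˣ)) : 𝔸)) := rfl

/-- The block mean of a constant is that constant (the weights sum to one, `|B(y)| = L^d`, `B7Prop1Explicit.sum_weights`).
[cite: Balaban1985Averaging, (78) p.30] -/
theorem bmean_const {L : ℕ} (hL : 1 ≤ L) (c : 𝔸) : bmean L (fun _ : Fin d → Fin L => c) = c := by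
  rw [bmean_apply, ← Finset.sum_smul, sum_weights L hL, one_smul]

/-- Additivity of the block mean. [folklore] -/
theorem bmean_add (L : ℕ) (f g : (Fin d → Fin L) → 𝔸) :
    bmean L (fun r => f r + g r) = bmean L f + bmean L g := by
  simp only [bmean_apply, smul_add, Finset.sum_add_distrib]

/-- The block mean commutes with negation. [folklore] -/
theorem bmean_neg (L : ℕ) (f : (Fin d → Fin L) → 𝔸) : bmean L (fun r => -f r) = -bmean L f := by
  simp only [bmean_apply, smul_neg, Finset.sum_neg_distrib]

/-- The block mean commutes with a constant rotation: `Σ L^{−d} R(w)f(x) = R(w) Σ L^{−d} f(x)`. [cite: Balaban1985Averaging, (169) p.44] -/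
theorem bmean_cj (L : ℕ) (w : 𝔸ˣ) (f : (Fin d → Fin L) → 𝔸) :
    bmean L (fun r => cj w (f r)) = cj w (bmean L f) := by
  simp only [bmean_apply, cj_sum, cj_smul]

/-- A block mean is bounded by the sup of its terms (the weights form a probability vector, `B7Prop1Explicit.norm_avg_le`).
[cite: Balaban1985Averaging, (78) p.30, (35) p.23] -/
theorem norm_bmean_le {L : ℕ} (hL : 1 ≤ L) {f : (Fin d → Fin L) → 𝔸} {M : ℝ} (hf : ∀ r, ‖f r‖ ≤ M) :
    ‖bmean L f‖ ≤ M :=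
  norm_avg_le L hL f hf

end BlockMean

/-! ## §4 The setting of p. 44 at the flat background and the factorisation (168) -/

section Eq168

variable {𝔸 : Type*} [NormedRing 𝔸] [NormedAlgebra ℂ 𝔸] [CompleteSpace 𝔸]

/-- The product `v(x) = v₁(x)v₂(x)e^{ir(x)}` of p. 44 (print's `e^{ir(x)}`, `r(x)` small, is `exp (R x)` with `‖R x‖` small —
the exponential form, cf. (109)). [cite: Balaban1985Averaging, p.44 (paragraph before (168))] -/
def vprod (v₁ v₂ : Site d → 𝔸ˣ) (R : Site d → 𝔸) : Site d → 𝔸ˣ := fun x => v₁ x * v₂ x * expUnit (R x)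

/-- `vprod_apply`: unfolding. [cite: Balaban1985Averaging, p.44 (paragraph before (168))] -/
@[simp] theorem vprod_apply (v₁ v₂ : Site d → 𝔸ˣ) (R : Site d → 𝔸) (x : Site d) :
    vprod v₁ v₂ R x = v₁ x * v₂ x * expUnit (R x) := rfl

/-- `exp` commutes with rotations: `e^{R(w)M} = R(w)e^{M}` ((57) p. 27, `B7Eq92Concrete.expUnit_conj`). [cite: Balaban1985Averaging, (57) p.27] -/
theorem exp_cj (w : 𝔸ˣ) (M : 𝔸) : exp (cj w M) = cj w (exp M) := by
  have h := congrArg (fun u : 𝔸ˣ => (u : 𝔸)) (expUnit_conj w M)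
  simpa only [val_expUnit, Rc_apply, Units.val_mul, cj_apply] using h

omit [CompleteSpace 𝔸] in
/-- `log` commutes with rotations: `log R(w)X = R(w) log X` ((57), `B7Prop6Flat.mlog_conj`). [cite: Balaban1985Averaging, (57) p.27] -/
theorem mlog_cj (w : 𝔸ˣ) (X : 𝔸) : mlog (cj w X) = cj w (mlog X) := by
  rw [cj_apply, mlog_conj, cj_apply]

/-- **(168), lines 1–2** (at `V₀ = 1`, so `R_{0,y} = id`), an identity in the group of units:
`v⁻¹(y)v(x) = e^{−ir(y)}·R(v₂⁻¹(y))[v₁⁻¹(y)v₁(x)]·v₂⁻¹(y)v₂(x)·e^{ir(x)}`.  Print: "v⁻¹(y)(R_{0,y}v)(x) =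
e^{−ir(y)}v₂⁻¹(y)v₁⁻¹(y)(R_{0,y}v₁)(x)·(R_{0,y}v₂)(x)e^{i(R_{0,y}r)(x)} = e^{−ir(y)}R(v₂⁻¹(y))[v₁⁻¹(y)(R_{0,y}v₁)(x)]·
v₂⁻¹(y)(R_{0,y}v₂)(x)e^{i(R_{0,y}r)(x)}". [cite: Balaban1985Averaging, (168) p.44] -/
theorem eq168_factor (v₁ v₂ : Site d → 𝔸ˣ) (R : Site d → 𝔸) (y x : Site d) :
    (vprod v₁ v₂ R y)⁻¹ * vprod v₁ v₂ R x =
      expUnit (-R y) * Rc (v₂ y)⁻¹ ((v₁ y)⁻¹ * v₁ x) * ((v₂ y)⁻¹ * v₂ x) * expUnit (R x) := by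
  rw [← val_inv_expUnit]
  simp only [vprod_apply, Rc_apply]
  group

variable (L : ℕ) (v₁ v₂ : Site d → 𝔸ˣ) (R : Site d → 𝔸) (y : Site d)

/-- The remainder of **(168), line 3**: `ρ(x) := log v⁻¹(y)v(x) − [−ir(y) + R(v₂⁻¹(y)) log v₁⁻¹(y)v₁(x) + log v₂⁻¹(y)v₂(x) + ir(x)]`
(the block point `x = y + r`). Print: "= exp[−ir(y) + iR(v₂⁻¹(y))(1/i) log v₁⁻¹(y)(R_{0,y}v₁)(x) + i(1/i) log v₂⁻¹(y)(R_{0,y}v₂)(x)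
+ i(R_{0,y}r)(x) + O((c₁ + c₂)²)]". [cite: Balaban1985Averaging, (168) p.44] -/
def rem168 (r : Fin d → Fin L) : 𝔸 :=
  mlog ((((vprod v₁ v₂ R y)⁻¹ * vprod v₁ v₂ R (y + boxVec L r) : 𝔸ˣ)) : 𝔸) -
    (-R y + cj (v₂ y)⁻¹ (mlog ((((v₁ y)⁻¹ * v₁ (y + boxVec L r) : 𝔸ˣ)) : 𝔸)) +
      mlog ((((v₂ y)⁻¹ * v₂ (y + boxVec L r) : 𝔸ˣ)) : 𝔸) + R (y + boxVec L r))

/-- `rem168_spec`: (168) line 3 as an identity, `log v⁻¹(y)v(x) = −ir(y) + R(v₂⁻¹(y)) log(…) + log(…) + ir(x) + ρ(x)`.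
[cite: Balaban1985Averaging, (168) p.44] -/
theorem rem168_spec (r : Fin d → Fin L) :
    mlog ((((vprod v₁ v₂ R y)⁻¹ * vprod v₁ v₂ R (y + boxVec L r) : 𝔸ˣ)) : 𝔸) =
      -R y + cj (v₂ y)⁻¹ (mlog ((((v₁ y)⁻¹ * v₁ (y + boxVec L r) : 𝔸ˣ)) : 𝔸)) +
        mlog ((((v₂ y)⁻¹ * v₂ (y + boxVec L r) : 𝔸ˣ)) : 𝔸) + R (y + boxVec L r) + rem168 L v₁ v₂ R y r := by
  rw [rem168]; abel

variable {L v₁ v₂ R y}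
variable {c₁ c₂ : ℝ}
  (hRy : ‖R y‖ ≤ c₁) (hR : ∀ r : Fin d → Fin L, ‖R (y + boxVec L r)‖ ≤ c₁)
  (hA₁ : ∀ r : Fin d → Fin L, ‖((((v₁ y)⁻¹ * v₁ (y + boxVec L r) : 𝔸ˣ)) : 𝔸) - 1‖ ≤ c₂)
  (hA₂ : ∀ r : Fin d → Fin L, ‖((((v₂ y)⁻¹ * v₂ (y + boxVec L r) : 𝔸ˣ)) : 𝔸) - 1‖ ≤ c₂)
  (hw : ‖((((v₂ y)⁻¹ : 𝔸ˣ)) : 𝔸) - 1‖ ≤ 2 / 5) (hw' : ‖((v₂ y : 𝔸ˣ) : 𝔸) - 1‖ ≤ 2 / 5)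

omit [NormedAlgebra ℂ 𝔸] [CompleteSpace 𝔸] in
include hw hw' in
/-- The rotation by `v₂⁻¹(y)` at most doubles norms (print: an isometry, `v₂` unitary). [cite: Balaban1985Averaging, (168) p.44] -/
theorem norm_cj_v₂_le (X : 𝔸) : ‖cj (v₂ y)⁻¹ X‖ ≤ 2 * ‖X‖ :=
  norm_cj_le_two_mul hw (by rw [inv_inv]; exact hw') X

include hA₁ in
/-- `‖log v₁⁻¹(y)v₁(x)‖ ≤ 2c₂` (`|log X| ≤ 2|X − 1|` for `|X − 1| ≤ ½`). [cite: Balaban1985Averaging, (168) p.44, (21) p.21] -/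
theorem norm_mlog_A₁_le (hc₂ : c₂ ≤ 1 / 2) (r : Fin d → Fin L) :
    ‖mlog ((((v₁ y)⁻¹ * v₁ (y + boxVec L r) : 𝔸ˣ)) : 𝔸)‖ ≤ 2 * c₂ :=
  (norm_mlog_le_two_mul ((hA₁ r).trans hc₂)).trans (by linarith [hA₁ r])

include hA₂ in
/-- `‖log v₂⁻¹(y)v₂(x)‖ ≤ 2c₂`. [cite: Balaban1985Averaging, (168) p.44, (21) p.21] -/
theorem norm_mlog_A₂_le (hc₂ : c₂ ≤ 1 / 2) (r : Fin d → Fin L) :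
    ‖mlog ((((v₂ y)⁻¹ * v₂ (y + boxVec L r) : 𝔸ˣ)) : 𝔸)‖ ≤ 2 * c₂ :=
  (norm_mlog_le_two_mul ((hA₂ r).trans hc₂)).trans (by linarith [hA₂ r])

include hRy hR hA₁ hA₂ hw hw' in
/-- **(168), line 3, kernel form with an explicit `O(1)`**: for `2c₁ + 6c₂ ≤ 1/20` the remainder satisfies
`‖ρ(x)‖ ≤ 5(2c₁ + 6c₂)²` (`≤ 180(c₁ + c₂)²`).  Proof = print's: the four factors of (168) lines 1–2 are the exponentials of
`−ir(y)`, `R(v₂⁻¹(y)) log v₁⁻¹(y)v₁(x)`, `log v₂⁻¹(y)v₂(x)`, `ir(x)` (norms `≤ c₁, 4c₂, 2c₂, c₁`), merged by (31) three times.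
[cite: Balaban1985Averaging, (168) p.44, (31) p.22, (38) p.23] -/
theorem norm_rem168_le (hs : 2 * c₁ + 6 * c₂ ≤ 1 / 20) (r : Fin d → Fin L) :
    ‖rem168 L v₁ v₂ R y r‖ ≤ 5 * (2 * c₁ + 6 * c₂) ^ 2 := by
  have hc₁ : 0 ≤ c₁ := (norm_nonneg _).trans hRy
  have hc₂ : 0 ≤ c₂ := (norm_nonneg _).trans (hA₁ r)
  have hc₂' : c₂ ≤ 1 / 2 := by linarith
  set x := y + boxVec L r with hx
  set A₁ : 𝔸ˣ := (v₁ y)⁻¹ * v₁ x with hA₁d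
  set A₂ : 𝔸ˣ := (v₂ y)⁻¹ * v₂ x with hA₂d
  set B₁ : 𝔸 := -R y with hB₁
  set B₂ : 𝔸 := cj (v₂ y)⁻¹ (mlog (A₁ : 𝔸)) with hB₂
  set B₃ : 𝔸 := mlog (A₂ : 𝔸) with hB₃
  set B₄ : 𝔸 := R x with hB₄
  have hn₁ : ‖B₁‖ ≤ c₁ := by rw [hB₁, norm_neg]; exact hRy
  have hm₁ : ‖mlog (A₁ : 𝔸)‖ ≤ 2 * c₂ := norm_mlog_A₁_le hA₁ hc₂' r
  have hn₂ : ‖B₂‖ ≤ 4 * c₂ := (norm_cj_v₂_le hw hw' _).trans (by linarith)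
  have hn₃ : ‖B₃‖ ≤ 2 * c₂ := norm_mlog_A₂_le hA₂ hc₂' r
  have hn₄ : ‖B₄‖ ≤ c₁ := hR r
  have hsum : ‖B₁‖ + ‖B₂‖ + ‖B₃‖ + ‖B₄‖ ≤ 2 * c₁ + 6 * c₂ := by linarith
  obtain ⟨ρ, hρ, hρn⟩ := exp_mul4_eq hsum hs
  -- the four factors are these exponentials
  have hlt₁ : ‖(A₁ : 𝔸) - 1‖ < 1 := lt_of_le_of_lt (hA₁ r) (by linarith)
  have hlt₂ : ‖(A₂ : 𝔸) - 1‖ < 1 := lt_of_le_of_lt (hA₂ r) (by linarith)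
  have hval : ((((vprod v₁ v₂ R y)⁻¹ * vprod v₁ v₂ R x : 𝔸ˣ)) : 𝔸) = exp B₁ * exp B₂ * exp B₃ * exp B₄ := by
    rw [eq168_factor, hB₂, exp_cj, exp_mlog hlt₁, hB₃, exp_mlog hlt₂]
    simp only [Units.val_mul, val_expUnit, val_Rc_eq_cj, hB₁, hB₄, hA₁d, hA₂d]
  have hZ : ‖B₁ + B₂ + B₃ + B₄ + ρ‖ ≤ 1 / 5 := by
    have h5 : 5 * (2 * c₁ + 6 * c₂) ^ 2 ≤ 1 / 20 := by nlinarith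
    calc ‖B₁ + B₂ + B₃ + B₄ + ρ‖ ≤ ‖B₁ + B₂ + B₃ + B₄‖ + ‖ρ‖ := norm_add_le _ _
      _ ≤ ‖B₁‖ + ‖B₂‖ + ‖B₃‖ + ‖B₄‖ + ‖ρ‖ := by gcongr; exact norm_add₄_le
      _ ≤ 1 / 5 := by linarith
  have hrem : rem168 L v₁ v₂ R y r = ρ := by
    rw [rem168, ← hx, hval, hρ, mlog_exp_of_le hZ]
    simp only [hB₁, hB₂, hB₃, hB₄, hA₁d, hA₂d]
    abel
  rw [hrem]; exact hρn

end Eq168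

/-! ## §5 (169)–(170): the average of the product, `(R̄₀v)(y) = (R̄₀v₁)(y)(R̄₀v₂)(y)e^{ir̄(y)}`, `|r̄(y)| < c₁ + C₃(c₁ + c₂)²` -/

section Eq170

variable {𝔸 : Type*} [NormedRing 𝔸] [NormedAlgebra ℂ 𝔸] [CompleteSpace 𝔸]
variable (L : ℕ) (v₁ v₂ : Site d → 𝔸ˣ) (R : Site d → 𝔸) (y : Site d)

/-- **`r̄(y)` of (169)–(170)** at `V₀ = 1`: `ir̄(y) := log [((R̄₀v₁)(y)(R̄₀v₂)(y))⁻¹(R̄₀v)(y)]`, the averages being the site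
averages (78) `B7Eq99Concrete.savg` (= `R0avg L 1`, `B7Eq99Concrete.R0avg_one_left`). [cite: Balaban1985Averaging, (169)–(170) pp.44–45] -/
def rbar : 𝔸 := mlog ((((savg L v₁ y * savg L v₂ y)⁻¹ * savg L (vprod v₁ v₂ R) y : 𝔸ˣ)) : 𝔸)

/-- The block mean `Σ_{x∈B(y)} L^{−d}(R_{0,y}r)(x)` of `r` (at `V₀ = 1`), the linear part of `r̄(y)` ((169) last lines).
[cite: Balaban1985Averaging, (169) p.44] -/
def rmean : 𝔸 := bmean L (fun r => R (y + boxVec L r))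

/-- **(169), the exponent**: `S_v(y) = −ir(y) + R(v₂⁻¹(y))S_{v₁}(y) + S_{v₂}(y) + Σ L^{−d} ir(x) + Σ L^{−d} ρ(x)` — print's
"= v₁(y)v₂(y) exp[iΣ L^{−d}R(v₂⁻¹(y))(1/i) log v₁⁻¹(y)(R_{0,y}v₁)(x) + iΣ L^{−d}(1/i) log v₂⁻¹(y)(R_{0,y}v₂)(x) + iΣ L^{−d}(R_{0,y}r)(x)
+ O((c₁+c₂)²)]" (the constant `−ir(y)` averages to itself, `Σ_{x∈B(y)} L^{−d} = 1`). [cite: Balaban1985Averaging, (169) p.44] -/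
theorem Sexp_vprod (hL : 1 ≤ L) :
    Sexp L (vprod v₁ v₂ R) y = -R y + cj (v₂ y)⁻¹ (Sexp L v₁ y) + Sexp L v₂ y + rmean L R y +
      bmean L (rem168 L v₁ v₂ R y) := by
  rw [Sexp_eq_bmean, Sexp_eq_bmean, Sexp_eq_bmean, rmean, ← bmean_cj]
  rw [show (-R y : 𝔸) = bmean L (fun _ : Fin d → Fin L => -R y) from (bmean_const hL _).symm]
  rw [← bmean_add, ← bmean_add, ← bmean_add, ← bmean_add]
  congr 1
  funext r
  rw [rem168_spec]

variable {L v₁ v₂ R y}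
variable {c₁ c₂ : ℝ}
  (hRy : ‖R y‖ ≤ c₁) (hR : ∀ r : Fin d → Fin L, ‖R (y + boxVec L r)‖ ≤ c₁)
  (hA₁ : ∀ r : Fin d → Fin L, ‖((((v₁ y)⁻¹ * v₁ (y + boxVec L r) : 𝔸ˣ)) : 𝔸) - 1‖ ≤ c₂)
  (hA₂ : ∀ r : Fin d → Fin L, ‖((((v₂ y)⁻¹ * v₂ (y + boxVec L r) : 𝔸ˣ)) : 𝔸) - 1‖ ≤ c₂)
  (hw : ‖((((v₂ y)⁻¹ : 𝔸ˣ)) : 𝔸) - 1‖ ≤ 2 / 5) (hw' : ‖((v₂ y : 𝔸ˣ) : 𝔸) - 1‖ ≤ 2 / 5)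

/-- The quotient `((R̄₀v₁)(y)(R̄₀v₂)(y))⁻¹(R̄₀v)(y)` as a product of four exponentials (the last three lines of (169) read
backwards): `e^{−S₂}·R(v₂⁻¹(y))e^{−S₁}·e^{ir(y)}·e^{S_v(y)}`, using `v₁v₂ exp[R(v₂⁻¹)X] = v₁e^{X}v₂` exactly.
[cite: Balaban1985Averaging, (169) p.44] -/
theorem quotient_factor :
    (savg L v₁ y * savg L v₂ y)⁻¹ * savg L (vprod v₁ v₂ R) y =
      expUnit (-Sexp L v₂ y) * Rc (v₂ y)⁻¹ (expUnit (-Sexp L v₁ y)) * expUnit (R y) *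
        expUnit (Sexp L (vprod v₁ v₂ R) y) := by
  rw [← val_inv_expUnit, ← val_inv_expUnit]
  simp only [savg_apply, vprod_apply, Rc_apply]
  group

include hRy hR hA₁ hA₂ hw hw' in
/-- **(169)–(170), kernel form at the flat background with an explicit constant.**  For site functions `v₁, v₂ : ℤ^d → 𝔸ˣ`,
`R : ℤ^d → 𝔸`, `v = v₁v₂e^{R}`, a block corner `y` and `L ≥ 1`, under `‖R‖ ≤ c₁` on `B(y)`, `‖v_i⁻¹(y)v_i(x) − 1‖ ≤ c₂`
(`x ∈ B(y)`, `i = 1, 2`), the near-isometry hypotheses `‖v₂(y)^{∓1} − 1‖ ≤ 2/5` and the smallness `2c₁ + 6c₂ ≤ 1/45`: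
`{v}_{B(y)} = {v₁}_{B(y)}·{v₂}_{B(y)}·e^{r̄(y)}` and `‖r̄(y)‖ ≤ c₁ + 31(2c₁ + 6c₂)²`.
Print (170): "(R̄₀v)(y) = (R̄₀v₁)(y)(R̄₀v₂)(y)e^{ir̄(y)}, |r̄(y)| < c₁ + C₃(c₁ + c₂)², y ∈ Ω′^{(1)}".
[cite: Balaban1985Averaging, (169)–(170) pp.44–45] -/
theorem eq170_flat (hL : 1 ≤ L) (hs : 2 * c₁ + 6 * c₂ ≤ 1 / 45) :
    savg L (vprod v₁ v₂ R) y = savg L v₁ y * savg L v₂ y * expUnit (rbar L v₁ v₂ R y) ∧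
      ‖rbar L v₁ v₂ R y‖ ≤ c₁ + 31 * (2 * c₁ + 6 * c₂) ^ 2 := by
  have hc₁ : 0 ≤ c₁ := (norm_nonneg _).trans hRy
  have hc₂ : 0 ≤ c₂ := (norm_nonneg _).trans (hA₂ fun _ => ⟨0, hL⟩)
  have hs' : 2 * c₁ + 6 * c₂ ≤ 1 / 20 := by linarith
  set s := 2 * c₁ + 6 * c₂ with hsdef
  have hs0 : 0 ≤ s := by rw [hsdef]; positivity
  -- norms of the ingredients
  have hρ : ∀ r, ‖rem168 L v₁ v₂ R y r‖ ≤ 5 * s ^ 2 := fun r => norm_rem168_le hRy hR hA₁ hA₂ hw hw' hs' r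
  have hρm : ‖bmean L (rem168 L v₁ v₂ R y)‖ ≤ 5 * s ^ 2 := norm_bmean_le hL hρ
  have hr₀ : ‖rmean L R y‖ ≤ c₁ := norm_bmean_le hL hR
  have hc₂' : c₂ ≤ 1 / 2 := by linarith
  have hS₁ : ‖Sexp L v₁ y‖ ≤ 2 * c₂ := by
    rw [Sexp_eq_bmean]; exact norm_bmean_le hL fun r => norm_mlog_A₁_le hA₁ hc₂' r
  have hS₂ : ‖Sexp L v₂ y‖ ≤ 2 * c₂ := by
    rw [Sexp_eq_bmean]; exact norm_bmean_le hL fun r => norm_mlog_A₂_le hA₂ hc₂' r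
  have hcS₁ : ‖cj (v₂ y)⁻¹ (Sexp L v₁ y)‖ ≤ 4 * c₂ := (norm_cj_v₂_le hw hw' _).trans (by linarith)
  have hSv := Sexp_vprod L v₁ v₂ R y hL
  have hSvn : ‖Sexp L (vprod v₁ v₂ R) y‖ ≤ c₁ + 4 * c₂ + 2 * c₂ + c₁ + 5 * s ^ 2 := by
    rw [hSv]
    calc _ ≤ ‖-R y + cj (v₂ y)⁻¹ (Sexp L v₁ y) + Sexp L v₂ y + rmean L R y‖ +
          ‖bmean L (rem168 L v₁ v₂ R y)‖ := norm_add_le _ _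
      _ ≤ ‖-R y‖ + ‖cj (v₂ y)⁻¹ (Sexp L v₁ y)‖ + ‖Sexp L v₂ y‖ + ‖rmean L R y‖ +
          ‖bmean L (rem168 L v₁ v₂ R y)‖ := by gcongr; exact norm_add₄_le
      _ ≤ _ := by rw [norm_neg]; linarith
  -- the quotient as four exponentials
  have h5s : 5 * s ^ 2 ≤ s / 4 := by nlinarith [mul_le_mul_of_nonneg_left hs' hs0]
  have hsum : ‖-Sexp L v₂ y‖ + ‖-cj (v₂ y)⁻¹ (Sexp L v₁ y)‖ + ‖R y‖ + ‖Sexp L (vprod v₁ v₂ R) y‖ ≤ 9 / 4 * s := by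
    rw [norm_neg, norm_neg]; linarith
  have hs94 : 9 / 4 * s ≤ 1 / 20 := by linarith
  obtain ⟨ρ', hρ', hρ'n⟩ := exp_mul4_eq hsum hs94
  have hval : ((((savg L v₁ y * savg L v₂ y)⁻¹ * savg L (vprod v₁ v₂ R) y : 𝔸ˣ)) : 𝔸) =
      exp (-Sexp L v₂ y) * exp (-cj (v₂ y)⁻¹ (Sexp L v₁ y)) * exp (R y) * exp (Sexp L (vprod v₁ v₂ R) y) := by
    rw [quotient_factor, ← cj_neg, exp_cj]
    simp only [Units.val_mul, val_expUnit, val_Rc_eq_cj]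
  have hsumB : -Sexp L v₂ y + -cj (v₂ y)⁻¹ (Sexp L v₁ y) + R y + Sexp L (vprod v₁ v₂ R) y =
      rmean L R y + bmean L (rem168 L v₁ v₂ R y) := by
    rw [hSv]; abel
  have hZn : ‖rmean L R y + bmean L (rem168 L v₁ v₂ R y) + ρ'‖ ≤ c₁ + 31 * s ^ 2 := by
    calc _ ≤ ‖rmean L R y‖ + ‖bmean L (rem168 L v₁ v₂ R y)‖ + ‖ρ'‖ := norm_add₃_le
      _ ≤ c₁ + 5 * s ^ 2 + 5 * (9 / 4 * s) ^ 2 := by linarith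
      _ ≤ c₁ + 31 * s ^ 2 := by nlinarith
  have hZ5 : ‖rmean L R y + bmean L (rem168 L v₁ v₂ R y) + ρ'‖ ≤ 1 / 5 := by
    refine hZn.trans ?_; nlinarith [mul_le_mul_of_nonneg_left hs' hs0]
  have hrbar : rbar L v₁ v₂ R y = rmean L R y + bmean L (rem168 L v₁ v₂ R y) + ρ' := by
    rw [rbar, hval, hρ', hsumB, mlog_exp_of_le hZ5]
  refine ⟨?_, hrbar ▸ hZn⟩
  have hu : (savg L v₁ y * savg L v₂ y)⁻¹ * savg L (vprod v₁ v₂ R) y = expUnit (rbar L v₁ v₂ R y) := by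
    apply Units.ext
    rw [hval, hρ', hsumB, val_expUnit, hrbar]
  rw [inv_mul_eq_iff_eq_mul] at hu
  rw [hu]

include hRy hR hA₁ hA₂ hw hw' in
/-- **(170) in print's shape** `|r̄(y)| < c₁ + C₃(c₁ + c₂)²` with the explicit admissible constant `C₃ = 1116` (`31·36`),
for `c₁, c₂ ≤ 1/400`. [cite: Balaban1985Averaging, (170) p.45] -/
theorem eq170_flat' (hL : 1 ≤ L) (hc₁ : c₁ ≤ 1 / 400) (hc₂ : c₂ ≤ 1 / 400) :
    savg L (vprod v₁ v₂ R) y = savg L v₁ y * savg L v₂ y * expUnit (rbar L v₁ v₂ R y) ∧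
      ‖rbar L v₁ v₂ R y‖ ≤ c₁ + 1116 * (c₁ + c₂) ^ 2 := by
  have hc₁0 : 0 ≤ c₁ := (norm_nonneg _).trans hRy
  have hc₂0 : 0 ≤ c₂ := (norm_nonneg _).trans (hA₂ fun _ => ⟨0, hL⟩)
  obtain ⟨h1, h2⟩ := eq170_flat hRy hR hA₁ hA₂ hw hw' hL (by linarith)
  refine ⟨h1, h2.trans ?_⟩
  have hsq : (2 * c₁ + 6 * c₂) ^ 2 ≤ 36 * (c₁ + c₂) ^ 2 := by nlinarith
  linarith

end Eq170

end Literature.MathematicalPhysics.QuantumFieldTheory.Balaban1983to89.B7Eq170Flat
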